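import Literature.Algebra.Homology.GroupCohomologySemilinear
import Mathlib.RingTheory.AdicCompletion.Basic
import HarnessLib

/-!
# Nakayama's lemma for group cohomology with `ϖ`-adically complete coefficients

Topic `Algebra/Homology`; namespace `Literature.Algebra.Homology`; theorems only (glue for Mathlib's
`groupCohomology` in the inhomogeneous-cochain model, continuing `GroupCohomologySemilinear`).

**Theorem** (`exists_eq_sum_smul_of_forall_exists_add_smul`, `span_range_eq_top_of_adicComplete`,
`moduleFinite_of_adicComplete`).  Let `A` be a representation of a group `G` over a commutative
ring `k`, `ϖ ∈ k`, and assume that `k` and the coefficient module `V = A.V` are `ϖ`-adically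
complete (every series `∑ ϖ^j a_j` converges) and `V` is `ϖ`-adically separated.  If finitely many
classes `c_i ∈ Hⁿ(G, A)` generate `Hⁿ(G, A)` modulo `ϖ` (every class is `∑ a_i c_i + ϖ y`), then
they generate `Hⁿ(G, A)`: **`Hⁿ(G, A) = ∑ k c_i`**.  In particular `Hⁿ(G, A)` is a finitely
generated `k`-module as soon as `Hⁿ(G, A)/ϖ` is (e.g. when it embeds in a finite `Hⁿ(G, A/ϖ)`).

No finiteness assumption on `G` is needed: the proof is the `ϖ`-adic iteration on COCHAINS
(which are `ϖ`-adically complete and separated with `V`, pointwise) — write a cocycle `ξ₀` as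
`∑ a_i z_i + ϖ ξ₁ + δ w₀`, iterate, and sum the `ϖ`-adically convergent series of coefficients and
of cochains; the error is divisible by every `ϖ^s` pointwise, hence zero.  This is the derived /
complete form of Nakayama's lemma ([Brown1982CohomologyGroups, VIII.4–5] for the finiteness context;
[Serre1971CohomologieGroupesDiscrets, §1.8 Remarque]: cohomology of type (FL) groups with finitely
generated coefficients is finitely generated — here we isolate the part of such statements that
only uses completeness of the coefficients), used in the tree to pass from the finiteness of
`H^q(Γ, V/ϖ)` (finite coefficients, `BorelSerre1973_finite_groupCohomology_congruenceSubgroup`) to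
the finite generation of `H^q(Γ, V)` for `ϖ`-adically complete lattices `V` (Hida theory,
`hidaControl_dominantOrdinaryPoint`).

## References

* K. S. Brown, *Cohomology of Groups*, GTM 87 (1982), III.1 (standard cochains), VIII.4–5
  (finiteness conditions) (held). [Brown1982CohomologyGroups]
* J.-P. Serre, *Cohomologie des groupes discrets*, Ann. of Math. Studies 70 (1971), §1.8.
  [Serre1971CohomologieGroupesDiscrets]
* H. Matsumura, *Commutative Ring Theory*, Cambridge Studies in Adv. Math. 8 (1986/87), §8,
  Thm. 8.4 (p. 58: `A` `I`-adically complete, `M` separated, `M/IM` generated by `ω̄_i` ⇒ `M`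
  generated by `ω_i`) (held; read 2026-08-16). [Matsumura1987]
-/

noncomputable section

open CategoryTheory groupCohomology
open scoped Pointwise

namespace Literature.Algebra.Homology

universe u

variable {k : Type u} [CommRing k] {G : Type u} [Group G] (A : Rep k G) (ϖ : k)

/-! ### Completeness of cochains, pointwise from the coefficients -/

/-- If every `ϖ`-adic series converges in `V`, the same holds for cochains `G^m → V` (pointwise).
[folklore] -/
theorem cochains_series_converge
    (hV : ∀ f : ℕ → A.V, ∃ L : A.V, ∀ s : ℕ, ∃ r : A.V,
      L - ∑ j ∈ Finset.range s, ϖ ^ j • f j = ϖ ^ s • r)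
    (m : ℕ) (F : ℕ → (inhomogeneousCochains A).X m) :
    ∃ L : (inhomogeneousCochains A).X m, ∀ s : ℕ, ∃ R : (inhomogeneousCochains A).X m,
      L - ∑ j ∈ Finset.range s, ϖ ^ j • F j = ϖ ^ s • R := by
  choose L hL using fun g : Fin m → G => hV fun j => F j g
  choose R hR using hL
  refine ⟨fun g => L g, fun s => ⟨fun g => R g s, funext fun g => ?_⟩⟩
  have h := hR g s
  simp only [Pi.sub_apply, Finset.sum_apply, Pi.smul_apply]
  exact h

/-! ### The adic Nakayama lemma for `Hⁿ(G, A)` -/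

/-- **Nakayama's lemma for `Hⁿ(G, A)` with `ϖ`-adically complete separated coefficients.**  If
`k` and `V = A.V` are `ϖ`-adically complete (series form), `V` is `ϖ`-adically separated, and the
classes `c_i` (`i ∈ ι` finite) generate `Hⁿ(G, A)` modulo `ϖ`, then every class is a
`k`-linear combination of the `c_i`. [cite: Brown1982CohomologyGroups, III.1 and VIII.5]
[cite: Serre1971CohomologieGroupesDiscrets, §1.8 Remarque] -/
theorem exists_eq_sum_smul_of_forall_exists_add_smul {ι : Type*} [Fintype ι] (n : ℕ)
    (c : ι → groupCohomology A n)
    (hc : ∀ x : groupCohomology A n, ∃ (a : ι → k) (y : groupCohomology A n),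
      x = ∑ i, a i • c i + ϖ • y)
    (hk : ∀ a : ℕ → k, ∃ b : k, ∀ s : ℕ, ∃ r : k, b - ∑ j ∈ Finset.range s, ϖ ^ j * a j = ϖ ^ s * r)
    (hV : ∀ f : ℕ → A.V, ∃ L : A.V, ∀ s : ℕ, ∃ r : A.V,
      L - ∑ j ∈ Finset.range s, ϖ ^ j • f j = ϖ ^ s • r)
    (hV' : ∀ v : A.V, (∀ s : ℕ, ∃ r : A.V, v = ϖ ^ s • r) → v = 0)
    (x : groupCohomology A n) : ∃ b : ι → k, x = ∑ i, b i • c i := by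
  classical
  -- cocycle lifts of the generators and of `x`
  choose z hz using fun i => π_surjective A n (c i)
  obtain ⟨ξ₀, rfl⟩ := π_surjective A n x
  -- one step of the iteration: `ξ = ∑ a_i z_i + ϖ ξ' + δ w`
  have step : ∀ ξ : cocycles A n, ∃ (a : ι → k) (ξ' : cocycles A n)
      (w : (inhomogeneousCochains A).X (n - 1)),
      ξ = ∑ i, a i • z i + ϖ • ξ' + toCocycles A (n - 1) n w := by
    intro ξ
    obtain ⟨a, y, hy⟩ := hc (groupCohomology.π A n ξ)
    obtain ⟨ξ', rfl⟩ := π_surjective A n y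
    have h : groupCohomology.π A n ξ = groupCohomology.π A n (∑ i, a i • z i + ϖ • ξ') := by
      rw [hy, map_add, map_sum, map_smul]
      congr 1
      exact Finset.sum_congr rfl fun i _ => by rw [map_smul, hz]
    obtain ⟨w, hw⟩ := (π_apply_eq_π_apply_iff A n _ _).1 h
    exact ⟨a, ξ', w, by rw [hw]; abel⟩
  choose fa fξ fw hstep using step
  -- the sequence of cocycles `ξ_s`
  let xs : ℕ → cocycles A n := fun s => Nat.rec ξ₀ (fun _ ξ => fξ ξ) s
  have xs_zero : xs 0 = ξ₀ := rfl
  have xs_succ : ∀ s, xs (s + 1) = fξ (xs s) := fun s => rfl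
  -- the unrolled identity
  have key : ∀ s : ℕ, ξ₀ = ∑ i, (∑ j ∈ Finset.range s, ϖ ^ j * fa (xs j) i) • z i + ϖ ^ s • xs s +
      toCocycles A (n - 1) n (∑ j ∈ Finset.range s, ϖ ^ j • fw (xs j)) := by
    intro s
    induction s with
    | zero => simp [xs_zero]
    | succ s ih =>
      have hs : xs s = ∑ i, fa (xs s) i • z i + ϖ • xs (s + 1) + toCocycles A (n - 1) n (fw (xs s)) := by
        rw [xs_succ]
        exact hstep (xs s)
      have expand : ϖ ^ s • xs s = ∑ i, (ϖ ^ s * fa (xs s) i) • z i + ϖ ^ (s + 1) • xs (s + 1) +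
          toCocycles A (n - 1) n (ϖ ^ s • fw (xs s)) := by
        conv_lhs => rw [hs]
        rw [smul_add, smul_add, Finset.smul_sum, map_smul, pow_succ, mul_smul]
        congr 2
        exact Finset.sum_congr rfl fun i _ => by rw [smul_smul]
      rw [ih, expand]
      simp only [Finset.sum_range_succ, add_smul, Finset.sum_add_distrib, map_add]
      abel
  -- limits of the coefficient series and of the cochain series
  choose b hb using fun i => hk fun j => fa (xs j) i
  choose rb hrb using hb
  obtain ⟨W, hW⟩ := cochains_series_converge A ϖ hV (n - 1) fun j => fw (xs j)
  choose R hR using hW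
  -- the error `D = ξ₀ - ∑ b_i z_i - δ W` is divisible by every `ϖ^s`
  set D : cocycles A n := ξ₀ - ∑ i, b i • z i - toCocycles A (n - 1) n W with hD
  have hdiv : ∀ s : ℕ, D = ϖ ^ s • (xs s - ∑ i, rb i s • z i - toCocycles A (n - 1) n (R s)) := by
    intro s
    have hb' : ∀ i, b i = ∑ j ∈ Finset.range s, ϖ ^ j * fa (xs j) i + ϖ ^ s * rb i s := fun i => by
      rw [← hrb i s, add_sub_cancel]
    have hW' : W = ∑ j ∈ Finset.range s, ϖ ^ j • fw (xs j) + ϖ ^ s • R s := by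
      rw [← hR s, add_sub_cancel]
    have hsum : ∑ i, b i • z i =
        ∑ i, (∑ j ∈ Finset.range s, ϖ ^ j * fa (xs j) i + ϖ ^ s * rb i s) • z i :=
      Finset.sum_congr rfl fun i _ => by rw [← hb' i]
    rw [hD, hsum, hW']
    conv_lhs => rw [key s]
    simp only [add_smul, Finset.sum_add_distrib, map_add, map_smul, smul_sub, Finset.smul_sum, mul_smul]
    abel
  have hD0 : D = 0 := by
    apply iCocycles_injective A n
    rw [map_zero]
    funext g
    refine hV' _ fun s => ⟨iCocycles A n (xs s - ∑ i, rb i s • z i - toCocycles A (n - 1) n (R s)) g, ?_⟩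
    conv_lhs => rw [hdiv s]
    rw [map_smul]
    rfl
  -- conclusion
  refine ⟨b, ?_⟩
  have hξ : ξ₀ = ∑ i, b i • z i + toCocycles A (n - 1) n W := by
    rw [← sub_eq_zero, ← hD0, hD]
    abel
  rw [hξ, map_add, map_sum, π_toCocycles, add_zero]
  exact Finset.sum_congr rfl fun i _ => by rw [map_smul, hz]

/-- Span form: under the completeness hypotheses, if `span (c_i) + ϖ Hⁿ(G, A) = Hⁿ(G, A)` then
`span (c_i) = Hⁿ(G, A)`. [cite: Matsumura1987, Thm. 8.4] -/
theorem span_range_eq_top_of_adicComplete {ι : Type*} [Fintype ι] (n : ℕ)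
    (c : ι → groupCohomology A n)
    (hc : Submodule.span k (Set.range c) ⊔ ϖ • (⊤ : Submodule k (groupCohomology A n)) = ⊤)
    (hk : ∀ a : ℕ → k, ∃ b : k, ∀ s : ℕ, ∃ r : k, b - ∑ j ∈ Finset.range s, ϖ ^ j * a j = ϖ ^ s * r)
    (hV : ∀ f : ℕ → A.V, ∃ L : A.V, ∀ s : ℕ, ∃ r : A.V,
      L - ∑ j ∈ Finset.range s, ϖ ^ j • f j = ϖ ^ s • r)
    (hV' : ∀ v : A.V, (∀ s : ℕ, ∃ r : A.V, v = ϖ ^ s • r) → v = 0) :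
    Submodule.span k (Set.range c) = ⊤ := by
  have hc' : ∀ x : groupCohomology A n, ∃ (a : ι → k) (y : groupCohomology A n),
      x = ∑ i, a i • c i + ϖ • y := by
    intro x
    have hx : x ∈ Submodule.span k (Set.range c) ⊔ ϖ • (⊤ : Submodule k (groupCohomology A n)) := by
      rw [hc]
      exact Submodule.mem_top
    obtain ⟨y, hy, z, hz, rfl⟩ := Submodule.mem_sup.1 hx
    obtain ⟨a, rfl⟩ := (Submodule.mem_span_range_iff_exists_fun k).1 hy
    obtain ⟨w, -, rfl⟩ := (Submodule.mem_smul_pointwise_iff_exists _ _ _).1 hz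
    exact ⟨a, w, rfl⟩
  refine Submodule.eq_top_iff'.2 fun x => ?_
  obtain ⟨b, rfl⟩ := exists_eq_sum_smul_of_forall_exists_add_smul A ϖ n c hc' hk hV hV' x
  exact Submodule.sum_mem _ fun i _ => Submodule.smul_mem _ _ (Submodule.subset_span ⟨i, rfl⟩)

/-- **`Hⁿ(G, A)` is finitely generated as soon as `Hⁿ(G, A)/ϖ` is**, for `ϖ`-adically complete
`k` and `ϖ`-adically complete separated coefficients `V`. [cite: Serre1971CohomologieGroupesDiscrets, §1.8 Remarque]
[cite: Matsumura1987, Thm. 8.4] -/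
theorem moduleFinite_of_adicComplete (n : ℕ)
    (hfg : Module.Finite k (groupCohomology A n ⧸ ϖ • (⊤ : Submodule k (groupCohomology A n))))
    (hk : ∀ a : ℕ → k, ∃ b : k, ∀ s : ℕ, ∃ r : k, b - ∑ j ∈ Finset.range s, ϖ ^ j * a j = ϖ ^ s * r)
    (hV : ∀ f : ℕ → A.V, ∃ L : A.V, ∀ s : ℕ, ∃ r : A.V,
      L - ∑ j ∈ Finset.range s, ϖ ^ j • f j = ϖ ^ s • r)
    (hV' : ∀ v : A.V, (∀ s : ℕ, ∃ r : A.V, v = ϖ ^ s • r) → v = 0) :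
    Module.Finite k (groupCohomology A n) := by
  classical
  set N : Submodule k (groupCohomology A n) := ϖ • ⊤ with hN
  obtain ⟨S, hS⟩ := hfg.fg_top
  -- lift the generators of the quotient
  choose lift hlift using fun y : groupCohomology A n ⧸ N => N.mkQ_surjective y
  let c : S → groupCohomology A n := fun s => lift s
  have hsup : Submodule.span k (Set.range c) ⊔ N = ⊤ := by
    refine Submodule.eq_top_iff'.2 fun x => ?_
    have hx : N.mkQ x ∈ Submodule.span k (S : Set (groupCohomology A n ⧸ N)) :=
      hS ▸ Submodule.mem_top
    have hmap : Submodule.span k (S : Set (groupCohomology A n ⧸ N)) =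
        Submodule.map N.mkQ (Submodule.span k (Set.range c)) := by
      rw [Submodule.map_span]
      congr 1
      ext y
      constructor
      · intro hy
        exact ⟨c ⟨y, hy⟩, ⟨⟨y, hy⟩, rfl⟩, hlift y⟩
      · rintro ⟨_, ⟨s, rfl⟩, rfl⟩
        rw [show N.mkQ (c s) = s from hlift s]
        exact s.2
    rw [hmap] at hx
    obtain ⟨y, hy, hyx⟩ := hx
    rw [Submodule.mkQ_apply, Submodule.mkQ_apply] at hyx
    have hxy : x - y ∈ N := (Submodule.Quotient.eq N).1 hyx.symm
    exact Submodule.mem_sup.2 ⟨y, hy, x - y, hxy, by abel⟩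
  have htop := span_range_eq_top_of_adicComplete A ϖ n c hsup hk hV hV'
  refine ⟨⟨(Finset.univ : Finset S).image c, ?_⟩⟩
  rw [Finset.coe_image, Finset.coe_univ, Set.image_univ]
  exact htop

/-! ### The hypotheses from Mathlib's `IsAdicComplete (Ideal.span {ϖ})` -/

section AdicComplete

variable {M : Type*} [AddCommGroup M] [Module k M]

omit [Group G] in
/-- `(ϖ)^s M = ϖ^s M`. [folklore] -/
theorem ideal_span_singleton_pow_smul_top (s : ℕ) :
    ((Ideal.span {ϖ}) ^ s • ⊤ : Submodule k M) = ϖ ^ s • ⊤ := by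
  rw [Ideal.span_singleton_pow, Submodule.ideal_span_singleton_smul]

omit [Group G] in
/-- **Every `ϖ`-adic series converges in a `ϖ`-adically (pre)complete module** (series form of
`IsPrecomplete (Ideal.span {ϖ}) M`). [cite: Matsumura1987, §8] -/
theorem series_converge_of_isPrecomplete [IsPrecomplete (Ideal.span {ϖ}) M] (a : ℕ → M) :
    ∃ L : M, ∀ s : ℕ, ∃ r : M, L - ∑ j ∈ Finset.range s, ϖ ^ j • a j = ϖ ^ s • r := by
  set f : ℕ → M := fun s => ∑ j ∈ Finset.range s, ϖ ^ j • a j with hf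
  have hcauchy : ∀ {m m'}, m ≤ m' → f m ≡ f m' [SMOD ((Ideal.span {ϖ}) ^ m • ⊤ : Submodule k M)] := by
    intro m m' hmm'
    rw [SModEq.sub_mem, ideal_span_singleton_pow_smul_top, hf]
    simp only
    rw [← Finset.sum_range_add_sum_Ico _ hmm', sub_add_cancel_left, Submodule.neg_mem_iff]
    refine Submodule.sum_mem _ fun j hj => ?_
    obtain ⟨d, rfl⟩ : ∃ d, j = m + d := ⟨j - m, by have := (Finset.mem_Ico.1 hj).1; omega⟩
    rw [pow_add, mul_smul]
    exact Submodule.smul_mem_pointwise_smul _ _ _ Submodule.mem_top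
  obtain ⟨L, hL⟩ := IsPrecomplete.prec' f hcauchy
  refine ⟨L, fun s => ?_⟩
  have h := hL s
  rw [SModEq.sub_mem, ideal_span_singleton_pow_smul_top] at h
  obtain ⟨r, -, hr⟩ := (Submodule.mem_smul_pointwise_iff_exists _ _ _).1 h
  exact ⟨-r, by rw [smul_neg, hr, neg_sub]⟩

omit [Group G] in
/-- The ring form (`M = k`): every `ϖ`-adic series of scalars converges. [cite: Matsumura1987, §8] -/
theorem series_converge_of_isPrecomplete' [IsPrecomplete (Ideal.span {ϖ}) k] (a : ℕ → k) :
    ∃ b : k, ∀ s : ℕ, ∃ r : k, b - ∑ j ∈ Finset.range s, ϖ ^ j * a j = ϖ ^ s * r := by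
  simpa only [smul_eq_mul] using series_converge_of_isPrecomplete ϖ (M := k) a

omit [Group G] in
/-- **An element divisible by every `ϖ^s` vanishes in a `ϖ`-adically separated module**
(`IsHausdorff (Ideal.span {ϖ}) M`). [cite: Matsumura1987, §8] -/
theorem eq_zero_of_forall_eq_pow_smul [IsHausdorff (Ideal.span {ϖ}) M] (v : M)
    (hv : ∀ s : ℕ, ∃ r : M, v = ϖ ^ s • r) : v = 0 := by
  refine IsHausdorff.haus' (I := Ideal.span {ϖ}) v fun s => ?_
  rw [SModEq.sub_mem, sub_zero, ideal_span_singleton_pow_smul_top]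
  obtain ⟨r, hr⟩ := hv s
  rw [hr]
  exact Submodule.smul_mem_pointwise_smul _ _ _ Submodule.mem_top

/-- **`Hⁿ(G, A)` is finitely generated when `Hⁿ(G, A)/ϖ` is, for `IsAdicComplete (ϖ)` scalars and
coefficients** (Mathlib-class form of `moduleFinite_of_adicComplete`). [cite: Serre1971CohomologieGroupesDiscrets, §1.8 Remarque]
[cite: Matsumura1987, Thm. 8.4] -/
theorem moduleFinite_of_isAdicComplete [IsPrecomplete (Ideal.span {ϖ}) k]
    [IsAdicComplete (Ideal.span {ϖ}) A.V] (n : ℕ)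
    (hfg : Module.Finite k (groupCohomology A n ⧸ ϖ • (⊤ : Submodule k (groupCohomology A n)))) :
    Module.Finite k (groupCohomology A n) :=
  moduleFinite_of_adicComplete A ϖ n hfg (series_converge_of_isPrecomplete' ϖ)
    (series_converge_of_isPrecomplete ϖ) (eq_zero_of_forall_eq_pow_smul ϖ)

end AdicComplete

end Literature.Algebra.Homology
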